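import Summits.ResolutionOfSingularities.ResolutionOfSingularities.Theorems.RadicialJungCleanModelsT2BlowupStalkChart
import Mathlib.RingTheory.Etale.Kaehler
import Mathlib.Algebra.Module.Projective
import HarnessLib

/-!
# Route `RadicialJung`, crux `CleanModels` (stmt-15917): projectivity of `Ω[·⁄ℤ]` along a ring
# isomorphism, and `Ω[R⁄ℤ]` projective for the image `R` of a stalk in `K(X)` (T2 brick B5-a,
# part 3 — item (g2) of res-L0-w81-pv-1's interface 20:56:36Z)

Support file (OURS) for PROGRAMME-clean-dim2 / T2, companion of
`RadicialJungCleanModelsT2BlowupStalkChart.lean`. Nothing here is a statement of Hironaka's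
manuscript.

The chart-level files of the programme (`RadicialJungCleanModelsLogContentIdealBlowup.lean`,
`…GiraudStepPoint`) work inside `K = K(X)` with the image `R ≤ K` of `𝒪_{X,ξ}` and assume
`[Module.Projective R Ω[R⁄ℤ]]`, which the tree proves for the stalk `𝒪_{X,ξ}` itself
(`projective_kaehler_stalk`). This file moves the hypothesis across the isomorphism `𝒪_{X,ξ} ≅ R`:

* `projective_kaehler_int_of_ringEquiv` — for a ring isomorphism `e : O ≃+* O'`,
  `Ω[O⁄ℤ]` projective ⇒ `Ω[O'⁄ℤ]` projective (an isomorphism is a localisation at `{1}`, and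
  `Ω` commutes with localisation: `Ω[O'⁄ℤ] ≅ O' ⊗_O Ω[O⁄ℤ]`);
* `projective_kaehler_range_stalk` — `Ω[R⁄ℤ]` is projective for `R = im(𝒪_{X,s} → K(X))`
  whenever `Ω[𝒪_{X,s}⁄ℤ]` is.
-/

noncomputable section

set_option linter.dupNamespace false -- mandated namespace of this single-conjunct summit

open CategoryTheory AlgebraicGeometry TopologicalSpace IsLocalRing
open Literature.AlgebraicGeometry.Resolution
open scoped TensorProduct

namespace Summit.ResolutionOfSingularities.ResolutionOfSingularities.Theorems.RadicialJung.CleanModels.T2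

universe u

/-- **Projectivity of the absolute Kähler differentials is invariant under ring isomorphisms**:
if `Ω[O⁄ℤ]` is a projective `O`-module and `e : O ≃+* O'`, then `Ω[O'⁄ℤ]` is a projective
`O'`-module. (Through `e`, `O'` is the localisation of `O` at the trivial submonoid, so
`Ω[O'⁄ℤ] ≅ O' ⊗_O Ω[O⁄ℤ]`.) [folklore] -/
theorem projective_kaehler_int_of_ringEquiv {O O' : Type u} [CommRing O] [CommRing O']
    (e : O ≃+* O') [Module.Projective O Ω[O⁄ℤ]] : Module.Projective O' Ω[O'⁄ℤ] := by
  letI : Algebra O O' := e.toRingHom.toAlgebra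
  have halg : (algebraMap O O' : O → O') = e := rfl
  -- `O'` is the localisation of `O` at `⊥ = {1}`
  haveI : IsLocalization (⊥ : Submonoid O) O' := by
    refine IsLocalization.of_le_isUnit_of_bijective ?_ (by rw [halg]; exact e.bijective)
    rintro _ ⟨x, hx, rfl⟩
    rw [SetLike.mem_coe, Submonoid.mem_bot] at hx
    rw [hx, map_one]
    exact isUnit_one
  -- `Ω[O'⁄ℤ] ≅ O' ⊗_O Ω[O⁄ℤ]`
  let eΩ : O' ⊗[O] Ω[O⁄ℤ] ≃ₗ[O'] Ω[O'⁄ℤ] :=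
    (IsLocalizedModule.isBaseChange (⊥ : Submonoid O) O' (KaehlerDifferential.map ℤ ℤ O O')).equiv
  exact Module.Projective.of_equiv eΩ

/-- **`Ω[R⁄ℤ]` is projective for the image `R` of `𝒪_{X,s}` in `K(X)`** whenever `Ω[𝒪_{X,s}⁄ℤ]`
is (e.g. `X` regular, locally of finite type over a field: `projective_kaehler_stalk`) — hypothesis
`[Module.Projective R Ω[R⁄ℤ]]` of the chart files `RadicialJungCleanModelsLogContentIdeal*.lean`.
[folklore] -/
theorem projective_kaehler_range_stalk {X : Scheme.{u}} [IsIntegral X] (s : X)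
    [Module.Projective (X.presheaf.stalk s) Ω[X.presheaf.stalk s⁄ℤ]] :
    Module.Projective (algebraMap (X.presheaf.stalk s) X.functionField).range
      Ω[(algebraMap (X.presheaf.stalk s) X.functionField).range⁄ℤ] := by
  obtain ⟨e, -⟩ := exists_ringEquiv_range _ (IsFractionRing.injective (X.presheaf.stalk s)
    X.functionField)
  exact projective_kaehler_int_of_ringEquiv e

end Summit.ResolutionOfSingularities.ResolutionOfSingularities.Theorems.RadicialJung.CleanModels.T2

end
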